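import Literature.AlgebraicGeometry.Resolution.MacaulayficationKawasakiStepFiveA
import HarnessLib

/-!
# Kawasaki's interwoven induction, Step 5, second half (Kawasaki 2000, proof of Thm. 3.1)

Topic: `Literature/AlgebraicGeometry/Resolution`. Brick of the proof of the named facts
`KawasakiMacaulayfication` / `CesnaviciusMacaulayfication`; sequel of
`MacaulayficationKawasakiStepFiveA.lean`. Second half of Step 5 of the printed proof of
Kawasaki 2000, Thm. 3.1 (pp. 2525–2526): (3.1.1) **in the case `k > i`** ("we work by induction
on `nᵢ`"), and the assembled implication **`(A_{i+1,j}) ∧ (C_{i+1,j}) ⇒ (A_ij)` for `j > i`**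
(`IsPStandard.kawasakiA31_of_succ`).

With `a` in the left-hand side: since `(xᵢ) + qᵢ^{nᵢ} = (xᵢ) + q_{i+1}^{nᵢ}`, `(A_{i+1,j})` for
the subsystem of parameters `y, xᵢ` of `M/q_{i+1}M` (with the exponent `nᵢ + n_{i+1}` at
`i + 1`) gives `a ∈ (y, xᵢ)M + (x_k,…,x_{l-1})q^{n'}M`; intersecting with `(y)M + q^nM` and using
the case `k = i` at `l = i + 1`, `a = xᵢa' + b`; by (2.9.2) for `y, x_k,…,x_{l-1}, xᵢ, x_l` on
`M/q_{l+1}M`, `a' ∈ (y,x_k,…,x_{l-1})M : x_l`, and `a'` is placed by `(A_{i+1,j})` if `nᵢ = 1`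
and by the statement for `nᵢ - 1` otherwise.

Everything is proved; no named fact is introduced.

## References

* [Kawasaki2000] T. Kawasaki, *On Macaulayfication of Noetherian schemes*, Trans. AMS 352 (2000)
  2517–2552, proof of Thm. 3.1, Step 5 (second half, pp. 2525–2526).
-/

namespace Literature.AlgebraicGeometry.Resolution

open Ideal Submodule Module IsLocalRing
open scoped Pointwise

universe u v

section Ring

variable {R : Type u} [CommRing R] {xs : List R}

/-- **The exponent shift of Step 5** (`k > i`): with `n' = n` except `n'_{i+1} = nᵢ + n_{i+1}`,
for `k ∈ [i+1, j]`:
`q_{i+1}^{n'_{i+1}}⋯q_k^{n'_k - 1}⋯qⱼ^{nⱼ} = q_{i+1}^{nᵢ} · (q_{i+1}^{n_{i+1}}⋯q_k^{n_k-1}⋯qⱼ^{nⱼ})`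
(`0`-based indices as in `prodPow`). [cite: Kawasaki2000, Thm. 3.1, Step 5] -/
theorem prodPow_update_shift {n : ℕ → ℕ} {i j k : ℕ} (hij : i + 1 ≤ j)
    (hk : k ∈ Finset.Icc (i + 1) j) (hni : 0 < n (i + 1)) :
    prodPow xs (Function.update (Function.update n (i + 1) (n i + n (i + 1))) k
        (Function.update n (i + 1) (n i + n (i + 1)) k - 1)) (i + 1) j =
      tailIdeal xs (i + 1) ^ n i * prodPow xs (Function.update n k (n k - 1)) (i + 1) j := by
  classical
  rw [Finset.mem_Icc] at hk
  rw [prodPow_eq_mul _ hij, prodPow_eq_mul _ hij, ← mul_assoc, ← pow_add]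
  congr 1
  · congr 1
    rcases eq_or_ne k (i + 1) with rfl | hk1
    · simp only [Function.update_self]; omega
    · rw [Function.update_of_ne hk1.symm, Function.update_self, Function.update_of_ne hk1.symm]
  · refine prodPow_congr fun t ht => ?_
    rw [Finset.mem_Icc] at ht
    rcases eq_or_ne t k with rfl | htk
    · rw [Function.update_self, Function.update_self, Function.update_of_ne (by omega)]
    · rw [Function.update_of_ne htk, Function.update_of_ne htk, Function.update_of_ne (by omega)]

/-- `q^{n} ⊆ (xᵢ₊₁) + q_{i+2}^{nᵢ + n_{i+1}} q_{i+3}^{n_{i+2}}⋯` ("Since `(xᵢ) + qᵢ^{nᵢ} = (xᵢ) + q_{i+1}^{nᵢ}`",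
Step 5). [cite: Kawasaki2000, Thm. 3.1, Step 5] -/
theorem prodPow_le_span_sup_shift {n : ℕ → ℕ} {i j : ℕ} (hij : i + 1 ≤ j) (hi : i < xs.length) :
    prodPow xs n i j ≤
      span {xs[i]} ⊔ prodPow xs (Function.update n (i + 1) (n i + n (i + 1))) (i + 1) j := by
  have hc : prodPow xs (Function.update n (i + 1) (n i + n (i + 1))) (i + 2) j =
      prodPow xs n (i + 2) j :=
    prodPow_congr fun t ht => Function.update_of_ne (by rw [Finset.mem_Icc] at ht; omega) _ _
  rw [prodPow_eq_mul _ (by omega : i ≤ j), prodPow_eq_mul _ hij, prodPow_eq_mul _ hij,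
    Function.update_self, hc, pow_add, mul_assoc]
  refine (Ideal.mul_mono_left (tailIdeal_pow_le_span_sup hi (n i))).trans ?_
  rw [Ideal.sup_mul]
  exact sup_le_sup_right Ideal.mul_le_right _

end Ring

variable {R : Type u} [CommRing R] [IsLocalRing R] [IsNoetherianRing R]
variable {M : Type v} [AddCommGroup M] [Module R M] [Module.Finite R M]

namespace IsPStandard

variable {xs : List R}

/-- **(2.9.2) for `y, x_k,…,x_{l-1}, xᵢ, x_l` on `M/q_{l+1}M`** (Step 5, `k > i`):
`(y, x_k,…,x_{l-1})M : xᵢx_l = (y, x_k,…,x_{l-1})M : x_l` for `i < k ≤ l < d`.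
[cite: Kawasaki2000, Thm. 3.1, Step 5] -/
theorem colonBy_seg_mul_eq_of_lt (hx : IsPStandard M xs) {i k l : ℕ} {ys : List R}
    (hys : IsSecantSequence M (xs.drop i ++ ys)) (hym : ∀ y ∈ ys, y ∈ maximalIdeal R)
    (hik : i < k) (hkl : k ≤ l) (hl : l < xs.length) :
    colonBy (ofList (ys ++ seg xs k l) • ⊤ : Submodule R M) (xs[i] * xs[l]) =
      colonBy (ofList (ys ++ seg xs k l) • ⊤ : Submodule R M) xs[l] := by
  classical
  have hi : i < xs.length := by omega
  have hS := hx.mem_maximalIdeal_drop_append i hym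
  have hdi : xs.drop i = xs[i] :: xs.drop (i + 1) := List.drop_eq_getElem_cons hi
  have hdk : xs.drop k = seg xs k l ++ xs[l] :: xs.drop (l + 1) := by
    rw [← List.drop_eq_getElem_cons hl, seg_append_drop hkl]
  -- the subsystem of parameters `y, x_k,…,x_{l-1}, xᵢ, x_l` of `M/q_{l+1}M`
  have hys2 : IsSecantSequence M (xs.drop (l + 1) ++ (((ys ++ seg xs k l) ++ [xs[i]]) ++ [xs[l]])) := by
    refine hys.of_subperm ⟨xs[i] :: (xs.drop k ++ ys), ?_, ?_⟩ hS
    · rw [hdk]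
      exact List.perm_iff_count.mpr fun r => by
        simp only [List.count_append, List.count_cons, List.count_nil]; omega
    · rw [hdi, List.cons_append]
      exact ((List.drop_sublist_drop_left xs hik).append (List.Sublist.refl ys)).cons_cons xs[i]
  have hym2 : ∀ y ∈ ((ys ++ seg xs k l) ++ [xs[i]]) ++ [xs[l]], y ∈ maximalIdeal R := by
    intro y hy
    simp only [List.mem_append, List.mem_singleton] at hy
    rcases hy with ((hy | hy) | rfl) | rfl
    · exact hym y hy
    · exact hx.mem_maximalIdeal y (List.mem_of_mem_drop ((seg_sublist_drop xs k l).subset hy))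
    · exact hx.mem_maximalIdeal _ (List.getElem_mem hi)
    · exact hx.mem_maximalIdeal _ (List.getElem_mem hl)
  have key := hx.colonBy_mul_eq_colonBy_nil (X₀ := xs.take (l + 1)) (D := xs.drop (l + 1))
    (List.take_append_drop _ xs).symm hys2 hym2 (Y := (ys ++ seg xs k l) ++ [xs[i]]) (yu := xs[l])
    rfl (Or.inr (hx.kills (xs.take l) xs[l] (xs.drop (l + 1))
      (by rw [← List.drop_eq_getElem_cons hl, List.take_append_drop])))
    (m := (ys ++ seg xs k l).length) (by simp)
  have e1 : (((ys ++ seg xs k l) ++ [xs[i]]) ++ [xs[l]]).take (ys ++ seg xs k l).length =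
      ys ++ seg xs k l := by
    rw [List.append_assoc, List.take_left]
  have e2 : (((ys ++ seg xs k l) ++ [xs[i]]) ++ [xs[l]])[(ys ++ seg xs k l).length]'(by simp) =
      xs[i] := by
    simp [List.getElem_append_right]
  rwa [e1, e2] at key

/-- **(3.1.1) in the case `k > i`, inclusion `⊆`, one induction step on `nᵢ`** (Kawasaki 2000,
proof of Thm. 3.1, Step 5): given `(A_{i+1,j})`, `(C_{i+1,j})` and a rule `place` putting
`xᵢa'` into the right-hand side whenever `a' ∈ (y,x_k,…,x_{l-1})M : x_l ∩ qᵢ^{nᵢ-1}q_{i+1}^{n_{i+1}}⋯M`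
(supplied by `(A_{i+1,j})` if `nᵢ = 1`, by the statement for `nᵢ - 1` otherwise).
[cite: Kawasaki2000, Thm. 3.1, Step 5] -/
theorem kawasakiA31_right_le (hx : IsPStandard M xs) {i j : ℕ} (hij : i + 1 ≤ j)
    (hj : j < xs.length) (hA : Kawasaki.A31 M xs (i + 1) j) (hC : Kawasaki.C31 M xs (i + 1) j)
    {n : ℕ → ℕ} (hn : Kawasaki.PosOn n i j) {ys : List R}
    (hys : IsSecantSequence M (xs.drop i ++ ys)) (hym : ∀ y ∈ ys, y ∈ maximalIdeal R)
    {k l : ℕ} (hik : i < k) (hkj : k ≤ j) (hkl : k ≤ l) (hl : l ≤ xs.length)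
    (place : ∀ hl : l < xs.length, ∀ a' : M,
      a' ∈ colonBy (ofList (ys ++ seg xs k l) • ⊤ : Submodule R M) xs[l] →
      a' ∈ (prodPow xs (Function.update n i (n i - 1)) i j • ⊤ : Submodule R M) →
        xs[i]'(by omega) • a' ∈ ofList ys • ⊤ ⊔ ofList (seg xs k l) •
          (prodPow xs (Function.update n k (n k - 1)) i j • (⊤ : Submodule R M))) :
    colonBy (ofList (ys ++ seg xs k l) • ⊤ : Submodule R M) (xs.getD l 1) ⊓
        (ofList ys • ⊤ ⊔ prodPow xs n i j • ⊤) ≤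
      ofList ys • ⊤ ⊔ ofList (seg xs k l) • (prodPow xs (Function.update n k (n k - 1)) i j • ⊤) := by
  classical
  have hi : i < xs.length := by omega
  have hiIcc : i ∈ Finset.Icc i j := Finset.mem_Icc.mpr ⟨le_rfl, by omega⟩
  have hkIcc : k ∈ Finset.Icc i j := Finset.mem_Icc.mpr ⟨hik.le, hkj⟩
  have hkIcc' : k ∈ Finset.Icc (i + 1) j := Finset.mem_Icc.mpr ⟨hik, hkj⟩
  have hnk : 0 < n k := hn k hkIcc
  -- `V = (x_k,…,x_{l-1})q^{n_k-1…}M ⊆ (y)M + q^nM`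
  have hV : ofList (seg xs k l) • (prodPow xs (Function.update n k (n k - 1)) i j •
      (⊤ : Submodule R M)) ≤ ofList ys • ⊤ ⊔ prodPow xs n i j • ⊤ :=
    le_sup_right.trans' (smul_prodPow_update_smul_le (ofList_seg_le_tailIdeal xs k l) hkIcc hnk ⊤)
  rcases hl.eq_or_lt with rfl | hl
  · -- `l = d + 1` (`1`-based): nothing to prove
    rw [seg_length]
    refine inf_le_right.trans (sup_le le_sup_left (le_sup_right.trans' ?_))
    rw [← Submodule.mul_smul, ← prodPow_eq_mul_update hkIcc hnk]
  intro a ha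
  obtain ⟨ha1, ha2⟩ := Submodule.mem_inf.mp ha
  rw [mem_colonBy, getD_eq_getElem hl] at ha1
  -- the subsystem of parameters `y, xᵢ` of `M/q_{i+1}M` and the exponents `n'`
  have hys' := hx.isSecantSequence_drop_succ_snoc hi hys hym
  have hym' : ∀ y ∈ ys ++ [xs[i]], y ∈ maximalIdeal R := fun y hy => by
    rcases List.mem_append.mp hy with hy | hy
    · exact hym y hy
    · rw [List.mem_singleton] at hy; rw [hy]
      exact hx.mem_maximalIdeal _ (List.getElem_mem hi)
  set n' : ℕ → ℕ := Function.update n (i + 1) (n i + n (i + 1)) with hn'def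
  have hn' : Kawasaki.PosOn n' (i + 1) j := by
    intro t ht
    rcases eq_or_ne t (i + 1) with rfl | ht1
    · rw [hn'def, Function.update_self]; have := hn i hiIcc; omega
    · rw [hn'def, Function.update_of_ne ht1]
      exact hn t (by rw [Finset.mem_Icc] at ht ⊢; omega)
  -- `(A_{i+1,j})`: `a ∈ (y, xᵢ)M + (x_k,…,x_{l-1})q^{…}M`
  have hA' := hA n' hn' (ys ++ [xs[i]]) hys' hym' k l hik hkj hkl hl.le
  have haA : a ∈ ofList (ys ++ [xs[i]]) • ⊤ ⊔ ofList (seg xs k l) •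
      (prodPow xs (Function.update n' k (n' k - 1)) (i + 1) j • (⊤ : Submodule R M)) := by
    rw [← hA']
    refine Submodule.mem_inf.mpr ⟨?_, ?_⟩
    · rw [mem_colonBy, getD_eq_getElem hl, ofList_append_smul]
      rw [ofList_append_smul] at ha1
      exact mem_sup_of_le_left (Submodule.smul_mono_left (ofList_mono_of_subset fun r hr =>
        List.mem_append_left _ hr)) ha1
    · have hle : (ofList ys • ⊤ ⊔ prodPow xs n i j • ⊤ : Submodule R M) ≤
          ofList (ys ++ [xs[i]]) • ⊤ ⊔ prodPow xs n' (i + 1) j • ⊤ := by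
        refine sup_le (le_sup_left.trans' (Submodule.smul_mono_left (ofList_mono_of_subset
          fun r hr => List.mem_append_left _ hr))) ?_
        refine (Submodule.smul_mono_left (prodPow_le_span_sup_shift (n := n) hij hi)).trans ?_
        rw [Submodule.sup_smul, ofList_append_smul, ofList_singleton]
        exact sup_le_sup_right le_sup_right _
      exact hle ha2
  -- the shifted product is contained in `q^{n_k - 1 …}`
  have hshift : prodPow xs (Function.update n' k (n' k - 1)) (i + 1) j ≤
      prodPow xs (Function.update n k (n k - 1)) i j := by
    rw [hn'def, prodPow_update_shift hij hkIcc' (hn _ (Finset.mem_Icc.mpr ⟨Nat.le_succ i, hij⟩)),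
      prodPow_eq_mul _ (by omega : i ≤ j), Function.update_of_ne (by omega : i ≠ k)]
    exact Ideal.mul_mono_left (Ideal.pow_right_mono (tailIdeal_antitone xs (Nat.le_succ i)) _)
  have haA' : a ∈ ofList (seg xs k l) • (prodPow xs (Function.update n k (n k - 1)) i j •
      (⊤ : Submodule R M)) ⊔ ofList (ys ++ [xs[i]]) • ⊤ := by
    rw [sup_comm]
    exact mem_sup_of_le_right (Submodule.smul_mono le_rfl (Submodule.smul_mono_left hshift)) haA
  -- "Taking intersection with `(y)M + q^nM`": modular law, then the case `k = i` at `l = i+1`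
  have hmod : a ∈ ofList (seg xs k l) • (prodPow xs (Function.update n k (n k - 1)) i j •
      (⊤ : Submodule R M)) ⊔ (ofList (ys ++ [xs[i]]) • ⊤ ⊓ (ofList ys • ⊤ ⊔ prodPow xs n i j • ⊤)) := by
    rw [← sup_inf_assoc_of_le _ hV]
    exact Submodule.mem_inf.mpr ⟨haA', ha2⟩
  have hleft := hx.kawasakiA31_left hij hj hA hC hn hys hym (l := i + 1) (Nat.le_succ i) (by omega)
  rw [seg_succ le_rfl hi, seg_self, List.nil_append, ofList_singleton] at hleft
  have hcap : (ofList (ys ++ [xs[i]]) • ⊤ : Submodule R M) ⊓ (ofList ys • ⊤ ⊔ prodPow xs n i j • ⊤) ≤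
      ofList ys • ⊤ ⊔ span {xs[i]} • (prodPow xs (Function.update n i (n i - 1)) i j • ⊤) := by
    rw [← hleft]
    exact inf_le_inf_right _ (le_colonBy _ _)
  obtain ⟨v, hv, w, hw, e1⟩ := Submodule.mem_sup.mp (mem_sup_of_le_right hcap hmod)
  obtain ⟨c₁, hc₁, t, ht, e2⟩ := Submodule.mem_sup.mp hw
  obtain ⟨a', ha', rfl⟩ := mem_span_singleton_smul_iff.mp ht
  -- `a' ∈ (y, x_k,…,x_{l-1})M : xᵢx_l = … : x_l` by (2.9.2)
  have hP : ∀ z ∈ ofList ys • ⊤ ⊔ ofList (seg xs k l) •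
      (prodPow xs (Function.update n k (n k - 1)) i j • (⊤ : Submodule R M)),
        z ∈ (ofList (ys ++ seg xs k l) • ⊤ : Submodule R M) := fun z hz => by
    rw [ofList_append_smul]
    exact mem_sup_of_le_right (Submodule.smul_mono le_rfl le_top) hz
  have ha'1 : a' ∈ colonBy (ofList (ys ++ seg xs k l) • ⊤ : Submodule R M) xs[l] := by
    rw [← hx.colonBy_seg_mul_eq_of_lt hys hym hik hkl hl, mem_colonBy, mul_comm, mul_smul]
    have e : xs[l] • (xs[i] • a') = xs[l] • a - xs[l] • c₁ - xs[l] • v := by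
      rw [← e1, ← e2]; simp only [smul_add]; abel
    rw [e]
    refine Submodule.sub_mem _ (Submodule.sub_mem _ ha1 (Submodule.smul_mem _ _ (hP c₁
      (Submodule.mem_sup_left hc₁)))) (Submodule.smul_mem _ _ (hP v (Submodule.mem_sup_right hv)))
  -- conclude `a = xᵢa' + (c₁ + v)`
  have e3 : a = xs[i] • a' + (c₁ + v) := by rw [← e1, ← e2]; abel
  rw [e3]
  exact Submodule.add_mem _ (place hl a' ha'1 ha')
    (Submodule.add_mem _ (Submodule.mem_sup_left hc₁) (Submodule.mem_sup_right hv))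

/-- **(3.1.1) in the case `k > i`** (Kawasaki 2000, proof of Thm. 3.1, Step 5, "In the case of
`k > i`, we work by induction on `nᵢ`"), given `(A_{i+1,j})`, `(C_{i+1,j})`.
[cite: Kawasaki2000, Thm. 3.1, Step 5] -/
theorem kawasakiA31_right (hx : IsPStandard M xs) {i j : ℕ} (hij : i + 1 ≤ j) (hj : j < xs.length)
    (hA : Kawasaki.A31 M xs (i + 1) j) (hC : Kawasaki.C31 M xs (i + 1) j)
    {n : ℕ → ℕ} (hn : Kawasaki.PosOn n i j) {ys : List R}
    (hys : IsSecantSequence M (xs.drop i ++ ys)) (hym : ∀ y ∈ ys, y ∈ maximalIdeal R)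
    {k l : ℕ} (hik : i < k) (hkj : k ≤ j) (hkl : k ≤ l) (hl : l ≤ xs.length) :
    colonBy (ofList (ys ++ seg xs k l) • ⊤ : Submodule R M) (xs.getD l 1) ⊓
        (ofList ys • ⊤ ⊔ prodPow xs n i j • ⊤) =
      ofList ys • ⊤ ⊔ ofList (seg xs k l) • (prodPow xs (Function.update n k (n k - 1)) i j • ⊤) := by
  classical
  have hi : i < xs.length := by omega
  have hiIcc : i ∈ Finset.Icc i j := Finset.mem_Icc.mpr ⟨le_rfl, by omega⟩
  have hkIcc : k ∈ Finset.Icc i j := Finset.mem_Icc.mpr ⟨hik.le, hkj⟩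
  have hkIcc' : k ∈ Finset.Icc (i + 1) j := Finset.mem_Icc.mpr ⟨hik, hkj⟩
  suffices key : ∀ (e : ℕ) (n : ℕ → ℕ), Kawasaki.PosOn n i j → n i = e + 1 →
      colonBy (ofList (ys ++ seg xs k l) • ⊤ : Submodule R M) (xs.getD l 1) ⊓
          (ofList ys • ⊤ ⊔ prodPow xs n i j • ⊤) ≤
        ofList ys • ⊤ ⊔ ofList (seg xs k l) •
          (prodPow xs (Function.update n k (n k - 1)) i j • ⊤) by
    refine le_antisymm (key (n i - 1) n hn (by have := hn i hiIcc; omega)) ?_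
    -- "The opposite inclusion is obvious"
    refine sup_le (le_inf ((Submodule.smul_mono_left (ofList_mono_of_subset fun r hr =>
      List.mem_append_left _ hr)).trans (le_colonBy _ _)) le_sup_left) (le_inf ?_ ?_)
    · refine (Submodule.smul_mono (ofList_mono_of_subset fun r hr => List.mem_append_right _ hr)
        le_top).trans (le_colonBy _ _)
    · exact le_sup_right.trans' (smul_prodPow_update_smul_le (ofList_seg_le_tailIdeal xs k l)
        hkIcc (hn k hkIcc) ⊤)
  intro e
  induction e with
  | zero =>
    intro n hn hne
    refine hx.kawasakiA31_right_le hij hj hA hC hn hys hym hik hkj hkl hl (fun hl a' ha'1 ha' => ?_)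
    -- `nᵢ = 1`: place `a'` by `(A_{i+1,j})` for `y` on `M/q_{i+1}M`
    have hQ : prodPow xs (Function.update n i (n i - 1)) i j = prodPow xs n (i + 1) j := by
      rw [prodPow_eq_mul _ (by omega : i ≤ j), Function.update_self, hne, Nat.zero_add,
        Nat.sub_self, pow_zero, one_mul]
      exact prodPow_congr fun t ht => Function.update_of_ne (by
        rw [Finset.mem_Icc] at ht; omega) _ _
    rw [hQ] at ha'
    have hA' := hA n (hn.mono (Nat.le_succ i) le_rfl) ys
      (hx.isSecantSequence_drop_of_le (Nat.le_succ i) hys hym) hym k l hik hkj hkl hl.le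
    have ha'2 : a' ∈ ofList ys • ⊤ ⊔ ofList (seg xs k l) •
        (prodPow xs (Function.update n k (n k - 1)) (i + 1) j • (⊤ : Submodule R M)) := by
      rw [← hA']
      exact Submodule.mem_inf.mpr ⟨by rwa [getD_eq_getElem hl], Submodule.mem_sup_right ha'⟩
    have hprod : span {xs[i]} * prodPow xs (Function.update n k (n k - 1)) (i + 1) j ≤
        prodPow xs (Function.update n k (n k - 1)) i j := by
      rw [prodPow_eq_mul (Function.update n k (n k - 1)) (by omega : i ≤ j),
        Function.update_of_ne (by omega : i ≠ k), hne, Nat.zero_add, pow_one]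
      exact Ideal.mul_mono_left ((Ideal.span_singleton_le_iff_mem _).mpr
        (getElem_mem_tailIdeal le_rfl hi))
    have hle : span {xs[i]} • (ofList ys • ⊤ ⊔ ofList (seg xs k l) •
        (prodPow xs (Function.update n k (n k - 1)) (i + 1) j • (⊤ : Submodule R M))) ≤
          ofList ys • ⊤ ⊔ ofList (seg xs k l) •
            (prodPow xs (Function.update n k (n k - 1)) i j • ⊤) := by
      rw [Submodule.smul_sup]
      refine sup_le_sup Submodule.smul_le_right ?_
      rw [← Submodule.mul_smul, mul_comm, Submodule.mul_smul]
      refine Submodule.smul_mono le_rfl ?_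
      rw [← Submodule.mul_smul]
      exact Submodule.smul_mono_left hprod
    exact hle (mem_span_singleton_smul_iff.mpr ⟨a', ha'2, rfl⟩)
  | succ e ihe =>
    intro n hn hne
    refine hx.kawasakiA31_right_le hij hj hA hC hn hys hym hik hkj hkl hl (fun hl a' ha'1 ha' => ?_)
    -- `nᵢ > 1`: place `a'` by the statement for `nᵢ - 1`
    have hnm : Kawasaki.PosOn (Function.update n i (n i - 1)) i j := hn.update (by omega)
    have ha'2 := ihe (Function.update n i (n i - 1)) hnm (by rw [Function.update_self]; omega)
      (Submodule.mem_inf.mpr ⟨by rwa [getD_eq_getElem hl], Submodule.mem_sup_right ha'⟩)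
    have hfun : Function.update (Function.update n i (n i - 1)) k
        (Function.update n i (n i - 1) k - 1) =
          Function.update (Function.update n k (n k - 1)) i
            (Function.update n k (n k - 1) i - 1) := by
      rw [Function.update_of_ne (by omega : k ≠ i), Function.update_of_ne (by omega : i ≠ k),
        Function.update_comm (by omega : i ≠ k)]
    rw [hfun] at ha'2
    have hle : span {xs[i]} • (ofList ys • ⊤ ⊔ ofList (seg xs k l) •
        (prodPow xs (Function.update (Function.update n k (n k - 1)) i
          (Function.update n k (n k - 1) i - 1)) i j • (⊤ : Submodule R M))) ≤
          ofList ys • ⊤ ⊔ ofList (seg xs k l) •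
            (prodPow xs (Function.update n k (n k - 1)) i j • ⊤) := by
      rw [Submodule.smul_sup]
      refine sup_le_sup Submodule.smul_le_right ?_
      rw [← Submodule.mul_smul, mul_comm, Submodule.mul_smul]
      exact Submodule.smul_mono le_rfl (smul_prodPow_update_smul_le
        ((Ideal.span_singleton_le_iff_mem _).mpr (getElem_mem_tailIdeal le_rfl hi)) hiIcc
        (by rw [Function.update_of_ne (by omega : i ≠ k)]; omega) ⊤)
    exact hle (mem_span_singleton_smul_iff.mpr ⟨a', ha'2, rfl⟩)

/-- **Step 5 of Kawasaki 2000, Thm. 3.1: if `j > i`, then `(A_ij)` comes from `(A_{i+1,j})` and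
`(C_{i+1,j})`.** [cite: Kawasaki2000, Thm. 3.1, Step 5] -/
theorem kawasakiA31_of_succ (hx : IsPStandard M xs) {i j : ℕ} (hij : i + 1 ≤ j) (hj : j < xs.length)
    (hA : Kawasaki.A31 M xs (i + 1) j) (hC : Kawasaki.C31 M xs (i + 1) j) :
    Kawasaki.A31 M xs i j := by
  intro n hn ys hys hym k l hik hkj hkl hl
  rcases hik.eq_or_lt with rfl | hik
  · exact hx.kawasakiA31_left hij hj hA hC hn hys hym hkl hl
  · exact hx.kawasakiA31_right hij hj hA hC hn hys hym hik hkj hkl hl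

end IsPStandard

end Literature.AlgebraicGeometry.Resolution
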